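import Literature.Analysis.FluidPDE.TypeIAncientMild
import Literature.Analysis.FluidPDE.AncientMildWeak
import Literature.Analysis.FluidPDE.AncientMildRepresentative
import Literature.Analysis.FluidPDE.NewtonPotentialHolder
import Literature.Analysis.FunctionSpaces.TestPairingLimits
import Summits.NavierStokesRegularity.NavierStokesRegularity.Theorems.HardyPointSinkHardyAncientLimitMild
import Summits.NavierStokesRegularity.NavierStokesRegularity.Theorems.SqueezeCycleExtremalElementExistsRegularity
import HarnessLib

/-!
# Crux `PolyhedralDssProfileExists` (X⁻, stmt-NavierStokesRegularity-1404), line `polyhedral_cell` —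
# stub `stub_smoothRepresentative_ae` (the smooth Oseen-gauge representative, slice-wise a.e. equal)

Registered stub `stub_smoothRepresentative_ae` (`--supports stmt-NavierStokesRegularity-1404`), the
first step of the converse reduction X⁻ ⇒ polyhedral cell.  A Type-I ancient mild solution `u` of
3-D Navier–Stokes in the tree's duality form (`IsAncientMildSolution 1 u`, measurable slices,
`HasTypeIDecay C₀ u`) has a representative `V` in the Koch–Nadirashvili–Seregin–Šverák Oseen gauge,
`IsTypeIAncientMild C₀ V` (jointly smooth on `t < 0`, divergence free, Oseen integral equation
between all pairs of negative times, `‖V(t,x)‖ ≤ C₀/√(−t)`), with the same Type-I space–time bound,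
with `V(t) = u(t)` a.e. for EVERY `t < 0`, and normalised by `V(t) = 0` for `t ≥ 0`.  No
self-similarity and no symmetry enter.

Proof (adapted from the landed `stub_rdssSmoothRepresentative` of crux `RdssProfileTruncation`,
file `Theorems/FilamentSkeletonRssRdssProfileTruncationSmoothRepresentative.lean`).
(1) Type-I spatial decay ⇒ `u` is weak-* continuous in time (`t ↦ ∫⟪u(t), θ⟫` continuous on
`(−∞,0)` for every test field `θ`, via the bounded translates `u(· + b)` and
`continuousOn_integral_inner_of_cylRadius_decay`), so `√(−t) u(t)` has a jointly measurable
modification (`exists_stronglyMeasurable_modification`); unnormalise and clamp: `w(t) = u(t)` a.e.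
for every `t < 0`, Type-I bound everywhere.  (2) The translates `w(· + b)`, `b < 0`, are bounded
weak solutions of KNSS (`IsBoundedAncientMildSolution.isBoundedWeakNSSolutionOn`), and
`‖w‖ ≤ C₀/‖x‖` gives the Morrey bound, so on every window `w` is a.e. a continuous Oseen-mild field
(`HardyAncientLimit.exists_oseenMild_repr_of_boundedWeak`: KNSS Lemma 3.1, the Morrey bound kills
the parasitic drift).  (3) Window representatives on `W_n = (−(n+2), −(n+2)⁻¹)` agree on overlaps
(continuous, a.e. equal on an open set) and glue to `V` (`V(t) = 0` for `t ≥ 0`); the Type-I bound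
is a closed condition; KNSS Prop. 4.1 (`isTypeIAncientMild_of_continuous_oseenMild`) gives
`IsTypeIAncientMild C₀ V`.  (4) From the joint a.e. equality on the strip, `V(t) = u(t)` a.e. for
a.e. `t < 0`; both `t ↦ ∫⟪V(t), θ⟫` (step (1) applied to `V`, an ancient mild solution in the
duality sense by `IsTypeIAncientMild.isAncientMildSolution`) and `t ↦ ∫⟪u(t), θ⟫` are continuous on
`(−∞, 0)` and agree a.e., hence everywhere; du Bois-Reymond
(`FunctionSpaces.ae_eq_of_forall_integral_inner_test_eq`) gives `V(t) = u(t)` a.e. for every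
`t < 0`.
-/

noncomputable section

-- the summit namespace `…NavierStokesRegularity.NavierStokesRegularity…` is the tree convention (D-0017)
set_option linter.dupNamespace false

namespace Summit.NavierStokesRegularity.NavierStokesRegularity.Theorems.PolyhedralDssProfileExists.PolyhedralCell

open MeasureTheory Set Function Filter Topology Metric
open Literature.Analysis.FluidPDE Literature.Analysis
open scoped RealInnerProductSpace ENNReal

/-! ## Helpers (re-proved from the template, whose helpers are private) -/

/-- From `‖v‖ ≤ C₀ / D` and `r ≤ D`, `0 < D`: `r ‖v‖ ≤ C₀`. -/
private theorem smoothReprAe_bounds {F : Type*} [SeminormedAddCommGroup F] {C₀ D r : ℝ} {v : F}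
    (h : ‖v‖ ≤ C₀ / D) (hrD : r ≤ D) (hD : 0 < D) : r * ‖v‖ ≤ C₀ :=
  -- adapted from Theorems/FilamentSkeletonRssRdssProfileTruncationSmoothRepresentative.lean
  calc r * ‖v‖ ≤ D * ‖v‖ := mul_le_mul_of_nonneg_right hrD (norm_nonneg _)
    _ ≤ D * (C₀ / D) := mul_le_mul_of_nonneg_left h hD.le
    _ = C₀ := mul_div_cancel₀ _ hD.ne'

/-- Under the Type-I bound, the translate `f(· + b)`, `b < 0`, is bounded by `C₀/√(−b)` on `t < 0`
and has the decay `r‖f‖ ≤ C₀` (`r ≤ ‖x‖` the cylindrical radius). -/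
private theorem smoothReprAe_translate
    {f : ℝ → EuclideanSpace ℝ (Fin 3) → EuclideanSpace ℝ (Fin 3)} {C₀ : ℝ}
    (hf : ∀ t < 0, ∀ x, ‖f t x‖ ≤ C₀ / (‖x‖ + √(-t))) {b : ℝ} (hb : b < 0) {s : ℝ}
    (hs : s < 0) (x : EuclideanSpace ℝ (Fin 3)) :
    ‖f (s + b) x‖ ≤ C₀ / √(-b) ∧ cylRadius x * ‖f (s + b) x‖ ≤ C₀ := by
  -- adapted from Theorems/FilamentSkeletonRssRdssProfileTruncationSmoothRepresentative.lean
  have h := hf (s + b) (by linarith) x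
  have hr : 0 < √(-b) := Real.sqrt_pos.2 (neg_pos.2 hb)
  have hrD : √(-b) ≤ ‖x‖ + √(-(s + b)) :=
    le_add_of_nonneg_of_le (norm_nonneg _) (Real.sqrt_le_sqrt (by linarith))
  have hD : 0 < ‖x‖ + √(-(s + b)) := hr.trans_le hrD
  have hcyl : cylRadius x ≤ ‖x‖ := by
    rw [cylRadius, EuclideanSpace.norm_eq, Fin.sum_univ_three]
    refine Real.sqrt_le_sqrt ?_
    simp only [Real.norm_eq_abs, sq_abs]
    nlinarith [sq_nonneg (x 2)]
  exact ⟨(le_div_iff₀' hr).2 (smoothReprAe_bounds h hrD hD),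
    smoothReprAe_bounds h (hcyl.trans (le_add_of_nonneg_right (Real.sqrt_nonneg _))) hD⟩

/-- **Weak-* continuity in time** of a Type-I ancient mild solution (duality form): near `t₀ < 0`
use the bounded translate `u(· + t₀/2)` and `continuousOn_integral_inner_of_cylRadius_decay`. -/
private theorem smoothReprAe_weakStar
    {u : ℝ → EuclideanSpace ℝ (Fin 3) → EuclideanSpace ℝ (Fin 3)} {C₀ : ℝ}
    (hu : IsAncientMildSolution 1 u) (hmeas : ∀ t < 0, AEStronglyMeasurable (u t) volume)
    (hC : HasTypeIDecay C₀ u) {θ : EuclideanSpace ℝ (Fin 3) → EuclideanSpace ℝ (Fin 3)}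
    (hθ : FunctionSpaces.IsTestFunctionOn (⊤ : TopologicalSpace.Opens _) θ) :
    ContinuousOn (fun t => ∫ x, ⟪u t x, θ x⟫) (Iio 0) := by
  -- adapted from Theorems/FilamentSkeletonRssRdssProfileTruncationSmoothRepresentative.lean
  intro t₀ ht₀
  obtain ⟨b, hb0, hbt⟩ : ∃ b : ℝ, b < 0 ∧ t₀ < b :=
    ⟨t₀ / 2, by linarith [mem_Iio.1 ht₀], by linarith [mem_Iio.1 ht₀]⟩
  have hbd := fun s (hs : s < 0) x => smoothReprAe_translate hC hb0 hs x
  have hmb : ∀ s < 0, AEStronglyMeasurable (u (s + b)) volume := fun s hs => hmeas _ (by linarith)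
  have hub : IsBoundedAncientMildSolution 1 (fun s => u (s + b)) :=
    ⟨hu.time_translate hb0.le, C₀ / √(-b), fun s hs x => (hbd s hs x).1⟩
  have key := continuousOn_integral_inner_of_cylRadius_decay (u := fun s => u (s + b))
    (fun s hs x => (hbd s hs x).1) hmb (fun s hs => hu.1 _ (by linarith))
    (fun φ hφ hdiv => hub.continuousOn_integral_inner one_pos hmb hφ hdiv)
    (fun s hs x => (hbd s hs x).2) hθ
  have h3 := (key.continuousAt (Iio_mem_nhds (by linarith))).comp_of_eq
    (continuous_sub_right b).continuousAt rfl
  refine (h3.congr (Eventually.of_forall fun t => ?_)).continuousWithinAt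
  simp only [comp_apply, sub_add_cancel]

/-- **A jointly measurable modification with the Type-I bound everywhere**: the family `√(−t) u(t)`
is bounded by `C₀` and weak-* continuous, hence has a jointly measurable modification
(`exists_stronglyMeasurable_modification`); divide by `√(−t)` and clamp to the Type-I constraint. -/
private theorem smoothReprAe_modification {E : Type*} [NormedAddCommGroup E]
    [InnerProductSpace ℝ E] [FiniteDimensional ℝ E] [MeasurableSpace E] [BorelSpace E]
    {u : ℝ → E → E} {C₀ : ℝ} (hC₀ : 0 ≤ C₀)
    (hmeas : ∀ t < 0, AEStronglyMeasurable (u t) volume) (hC : HasTypeIDecay C₀ u)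
    (hws : ∀ θ : E → E, FunctionSpaces.IsTestFunctionOn (⊤ : TopologicalSpace.Opens E) θ →
      ContinuousOn (fun t => ∫ x, ⟪u t x, θ x⟫) (Iio 0)) :
    ∃ w : ℝ → E → E, StronglyMeasurable (uncurry w) ∧ (∀ t < 0, w t =ᵐ[volume] u t) ∧
      ∀ t < 0, ∀ x, ‖w t x‖ ≤ C₀ / (‖x‖ + √(-t)) := by
  -- adapted from Theorems/FilamentSkeletonRssRdssProfileTruncationSmoothRepresentative.lean
  have hM : ∀ t < 0, ∀ x, ‖√(-t) • u t x‖ ≤ C₀ := fun t ht x => by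
    rw [norm_smul, Real.norm_of_nonneg (Real.sqrt_nonneg _)]
    exact smoothReprAe_bounds (hC t ht x) (le_add_of_nonneg_left (norm_nonneg _))
      (add_pos_of_nonneg_of_pos (norm_nonneg _) (Real.sqrt_pos.2 (neg_pos.2 ht)))
  obtain ⟨w₀, hw₀m, hw₀u⟩ := exists_stronglyMeasurable_modification
    (u := fun t x => √(-t) • u t x) hM (fun t ht => (hmeas t ht).const_smul (√(-t)))
    fun θ hθ => ((Real.continuous_sqrt.comp continuous_neg).continuousOn.mul (hws θ hθ)).congr
      fun t _ => by simp only [Pi.mul_apply, comp_apply, real_inner_smul_left, integral_const_mul]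
  have h1 : StronglyMeasurable fun z : ℝ × E => (√(-z.1))⁻¹ • w₀ z.1 z.2 :=
    measurable_fst.neg.sqrt.inv.stronglyMeasurable.smul hw₀m
  have h2 : MeasurableSet {z : ℝ × E | ‖(√(-z.1))⁻¹ • w₀ z.1 z.2‖ ≤ C₀ / (‖z.2‖ + √(-z.1))} :=
    measurableSet_le h1.measurable.norm
      (measurable_const.div (measurable_snd.norm.add measurable_fst.neg.sqrt))
  set w : ℝ → E → E := fun t x => if ‖(√(-t))⁻¹ • w₀ t x‖ ≤ C₀ / (‖x‖ + √(-t))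
    then (√(-t))⁻¹ • w₀ t x else 0 with hw
  refine ⟨w, StronglyMeasurable.ite h2 h1 stronglyMeasurable_const, fun t ht => ?_,
    fun t ht x => ?_⟩
  · filter_upwards [hw₀u t ht] with x hx
    have e : (√(-t))⁻¹ • w₀ t x = u t x := by
      rw [hx, smul_smul, inv_mul_cancel₀ (Real.sqrt_pos.2 (neg_pos.2 ht)).ne', one_smul]
    simp only [hw]
    rw [if_pos (by rw [e]; exact hC t ht x), e]
  · simp only [hw]
    split_ifs with h
    · exact h
    · rw [norm_zero]; positivity

/-- **The Morrey bound from the Type-I bound**: `‖w(t, y)‖ ≤ C₀/‖y‖` gives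
`∫_{B_m(0)} ‖w(t)‖² ≤ C₀² ∫_{B_m} |y|^{-2} = 3|B₁| C₀² m`. -/
private theorem smoothReprAe_morrey
    {w : ℝ → EuclideanSpace ℝ (Fin 3) → EuclideanSpace ℝ (Fin 3)} {C₀ : ℝ}
    (hwb : ∀ t < 0, ∀ x, ‖w t x‖ ≤ C₀ / (‖x‖ + √(-t))) {t : ℝ} (ht : t < 0) {m : ℕ}
    (hm : 1 ≤ m) : ∫⁻ y in ball (0 : EuclideanSpace ℝ (Fin 3)) m, ‖w t y‖ₑ ^ 2 ≤
      ENNReal.ofReal (C₀ ^ 2 *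
        (3 * (volume : Measure (EuclideanSpace ℝ (Fin 3))).real (ball 0 1)) * m) := by
  -- adapted from Theorems/FilamentSkeletonRssRdssProfileTruncationSmoothRepresentative.lean
  have hm0 : (0 : ℝ) < m := by exact_mod_cast hm
  have hpt : ∀ᵐ y ∂(volume.restrict (ball (0 : EuclideanSpace ℝ (Fin 3)) m)),
      ‖w t y‖ₑ ^ 2 ≤ ENNReal.ofReal (C₀ ^ 2) * ENNReal.ofReal (‖y‖ ^ (-(2 : ℝ))) := by
    refine (ae_restrict_of_ae (measure_eq_zero_iff_ae_notMem.1
      (measure_singleton (0 : EuclideanSpace ℝ (Fin 3))))).mono fun y hy => ?_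
    have hy0 : 0 < ‖y‖ := norm_pos_iff.2 hy
    have h1 : ‖w t y‖ ≤ C₀ / ‖y‖ := (le_div_iff₀' hy0).2 (smoothReprAe_bounds (hwb t ht y)
      (le_add_of_nonneg_right (Real.sqrt_nonneg _)) (by positivity))
    have h2 : ‖w t y‖ ^ 2 ≤ C₀ ^ 2 * ‖y‖ ^ (-(2 : ℝ)) := by
      rw [Real.rpow_neg hy0.le, Real.rpow_two, ← div_eq_mul_inv, ← div_pow]
      exact pow_le_pow_left₀ (norm_nonneg _) h1 2
    rw [← ENNReal.ofReal_mul (sq_nonneg _), ← ofReal_norm, ← ENNReal.ofReal_pow (norm_nonneg _)]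
    exact ENNReal.ofReal_le_ofReal h2
  refine (lintegral_mono_ae hpt).trans_eq ?_
  rw [lintegral_const_mul' _ _ ENNReal.ofReal_ne_top,
    NewtonPotentialHolder.lintegral_ball_norm_rpow_neg (by norm_num) hm0,
    ← ENNReal.ofReal_mul (sq_nonneg _)]
  congr 1
  norm_num
  ring

/-- Transport of an a.e. statement on a set along a null-set preserving map. -/
private theorem smoothReprAe_ae_comp {α : Type*} [MeasurableSpace α] {μ : Measure α} {f : α → α}
    (hf : Measure.QuasiMeasurePreserving f μ μ) {s s' : Set α} (hs : MeasurableSet s)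
    (hs' : MeasurableSet s') (hmaps : MapsTo f s s') {p : α → Prop}
    (h : ∀ᵐ z ∂(μ.restrict s'), p z) : ∀ᵐ z ∂(μ.restrict s), p (f z) := by
  -- adapted from Theorems/FilamentSkeletonRssRdssProfileTruncationSmoothRepresentative.lean
  rw [ae_restrict_iff' hs'] at h
  rw [ae_restrict_iff' hs]
  exact (hf.ae h).mono fun z hz hzs => hz (hmaps hzs)

/-! ## The stub -/

/-- **stub_smoothRepresentative_ae** (the smooth Oseen-gauge representative).  A Type-I ancient
mild solution `u` of 3-D Navier–Stokes in the tree's duality form (`IsAncientMildSolution 1 u`,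
measurable slices, `HasTypeIDecay C₀ u`) has a representative `V` in the Oseen (KNSS) gauge
`IsTypeIAncientMild C V` — jointly smooth on `t < 0`, divergence free, satisfying the Oseen integral
equation between all pairs of negative times — with the same Type-I space–time bound
`HasTypeIDecay C₀ V`, equal to `u(t)` a.e. on EVERY negative slice, and vanishing for `t ≥ 0`.
Steps (module docstring): jointly measurable modification `w`; bounded weak translates
(`IsBoundedAncientMildSolution.isBoundedWeakNSSolutionOn`); window representatives
(`HardyAncientLimit.exists_oseenMild_repr_of_boundedWeak`, KNSS Lemma 3.1 + Morrey bound) glued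
along `W_n = (−(n+2), −(n+2)⁻¹)`; KNSS Prop. 4.1 (`isTypeIAncientMild_of_continuous_oseenMild`);
slice a.e. equality for a.e. `t` upgraded to every `t < 0` by weak-* continuity of both `V` and `u`
and du Bois-Reymond (Koch–Nadirashvili–Seregin–Šverák 2009, §4 and §6). -/
theorem stub_smoothRepresentative_ae :
    ∀ (u : ℝ → EuclideanSpace ℝ (Fin 3) → EuclideanSpace ℝ (Fin 3)) (C₀ : ℝ),
      IsAncientMildSolution 1 u → (∀ t < 0, AEStronglyMeasurable (u t) volume) → HasTypeIDecay C₀ u →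
      ∃ (V : ℝ → EuclideanSpace ℝ (Fin 3) → EuclideanSpace ℝ (Fin 3)) (C : ℝ),
        IsTypeIAncientMild C V ∧ HasTypeIDecay C₀ V ∧ (∀ t < 0, V t =ᵐ[volume] u t) ∧
        (∀ t, 0 ≤ t → V t = 0) := by
  intro u C₀ hu hmeas hC
  have hC₀ : 0 ≤ C₀ := by simpa using (norm_nonneg _).trans (hC (-1) (by norm_num) 0)
  -- ## Step 1: weak-* continuity and the jointly measurable modification `w`
  have hws := fun θ hθ => smoothReprAe_weakStar hu hmeas hC (θ := θ) hθ
  obtain ⟨w, hsm, hwu, hwb⟩ := smoothReprAe_modification hC₀ hmeas hC hws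
  have hS : MeasurableSet (Iio (0 : ℝ) ×ˢ (univ : Set (EuclideanSpace ℝ (Fin 3)))) :=
    measurableSet_Iio.prod .univ
  -- ## Step 2: the translates `w(· + b)`, `b < 0`, are bounded weak solutions of KNSS
  have hbw : ∀ b < 0, IsBoundedWeakNSSolutionOn (Iio 0) isOpen_Iio 1 (fun t => w (t + b)) := by
    intro b hb
    have hub : IsBoundedAncientMildSolution 1 (fun t => u (t + b)) := ⟨hu.time_translate hb.le,
      C₀ / √(-b), fun t ht x => (smoothReprAe_translate hC hb (mem_Iio.1 ht) x).1⟩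
    exact (hub.congr_ae_slice (fun t ht => hwu (t + b) (by linarith)) ⟨C₀ / √(-b),
      fun t ht x => (smoothReprAe_translate hwb hb (mem_Iio.1 ht) x).1⟩).isBoundedWeakNSSolutionOn
      one_pos (hsm.comp_measurable ((measurable_fst.add_const b).prodMk
        measurable_snd)).aestronglyMeasurable
      fun t ht => (hmeas (t + b) (by linarith)).congr (hwu (t + b) (by linarith)).symm
  -- ## window representatives on `W_n = (a, d)`, `a = -(n+2)`, `d = -(n+2)⁻¹`
  have hwin : ∀ n : ℕ, ∃ v : ℝ → EuclideanSpace ℝ (Fin 3) → EuclideanSpace ℝ (Fin 3),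
      ContinuousOn (uncurry v) (Ioo (-(n + 2 : ℝ)) (-(n + 2 : ℝ)⁻¹) ×ˢ univ) ∧
      (∀ t ∈ Ioo (-(n + 2 : ℝ)) (-(n + 2 : ℝ)⁻¹), IsWeaklyDivFree (v t)) ∧
      (∀ s t : ℝ, s ∈ Ioo (-(n + 2 : ℝ)) (-(n + 2 : ℝ)⁻¹) →
        t ∈ Ioo (-(n + 2 : ℝ)) (-(n + 2 : ℝ)⁻¹) → s < t → ∀ x,
        v t x = UnboundedOperators.heatExtension (v s) (t - s) x - oseenDuhamel 1 s v v t x) ∧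
      ∀ᵐ z ∂(volume.restrict
        (Ioo (-(n + 2 : ℝ)) (-(n + 2 : ℝ)⁻¹) ×ˢ (univ : Set (EuclideanSpace ℝ (Fin 3))))),
        uncurry w z = uncurry v z := by
    intro n
    have hd : -(n + 2 : ℝ)⁻¹ < 0 := neg_neg_of_pos (inv_pos.2 (by positivity))
    have had : -(n + 2 : ℝ) < -(n + 2 : ℝ)⁻¹ := by
      linarith [inv_lt_one_of_one_lt₀ (by linarith [n.cast_nonneg (α := ℝ)] : (1 : ℝ) < n + 2)]
    set d : ℝ := -(n + 2 : ℝ)⁻¹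
    set a : ℝ := -(n + 2 : ℝ)
    -- `w(· + a)` is a bounded weak solution on `(0, d - a)`, bounded, with the Morrey bound
    have hJI : ∀ τ : ℝ, τ ∈ Ioo 0 (d - a) ↔ τ + (a - d) ∈ Ioo (a - d) 0 := fun τ =>
      ⟨fun h => ⟨by linarith [h.1], by linarith [h.2]⟩, fun h => ⟨by linarith [h.1], by
        linarith [h.2]⟩⟩
    have hbw' : IsBoundedWeakNSSolutionOn (Ioo 0 (d - a)) isOpen_Ioo 1 (fun τ => w (τ + a)) := by
      convert ((hbw d hd).mono isOpen_Ioo Ioo_subset_Iio_self).comp_add_right (a - d) isOpen_Ioo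
        hJI using 2
      simp only [add_assoc, sub_add_cancel]
    have hM : ∀ τ ∈ Ioo 0 (d - a), ∀ x, ‖w (τ + a) x‖ ≤ C₀ / √(-d) := fun τ hτ x => by
      have h := (smoothReprAe_translate hwb hd (s := τ + a - d) (by linarith [hτ.2]) x).1
      rwa [sub_add_cancel] at h
    have hMor : ∀ᵐ τ ∂(volume.restrict (Ioo 0 (d - a))), ∀ m : ℕ, 1 ≤ m →
        ∫⁻ y in ball (0 : EuclideanSpace ℝ (Fin 3)) m, ‖w (τ + a) y‖ₑ ^ 2 ≤
          ENNReal.ofReal (C₀ ^ 2 *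
            (3 * (volume : Measure (EuclideanSpace ℝ (Fin 3))).real (ball 0 1)) * m) :=
      (ae_restrict_mem measurableSet_Ioo).mono fun τ hτ m hm =>
        smoothReprAe_morrey hwb (by linarith [hτ.2]) hm
    obtain ⟨v, hvc, hvd, hvm, hvae⟩ := HardyAncientLimit.exists_oseenMild_repr_of_boundedWeak
      (sub_pos.2 had) hbw' hM (by positivity) hMor
    -- translate back
    refine ⟨fun t x => v (t - a) x, ?_, fun t ht => hvd (t - a) ⟨by linarith [ht.1], by
      linarith [ht.2]⟩, fun s t hs ht hst x => ?_, ?_⟩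
    · exact hvc.comp (f := fun q : ℝ × EuclideanSpace ℝ (Fin 3) => (q.1 - a, q.2))
        ((continuous_fst.sub continuous_const).prodMk continuous_snd).continuousOn fun q hq =>
        ⟨⟨sub_pos.2 hq.1.1, by linarith [hq.1.2]⟩, mem_univ _⟩
    · have h1 := hvm (s - a) (t - a) (by linarith [hs.1]) (by linarith) (by linarith [ht.2]) x
      rw [show t - a - (s - a) = t - s by ring] at h1
      show v (t - a) x = UnboundedOperators.heatExtension (v (s - a)) (t - s) x -
        oseenDuhamel 1 s (fun τ => v (τ - a)) (fun τ => v (τ - a)) t x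
      rwa [oseenDuhamel_comp_sub_right]
    · have hq : Measure.QuasiMeasurePreserving
          (Prod.map (fun t : ℝ => t - a) (id : EuclideanSpace ℝ (Fin 3) → EuclideanSpace ℝ (Fin 3)))
          (volume : Measure (ℝ × EuclideanSpace ℝ (Fin 3))) volume := by
        rw [Measure.volume_eq_prod]
        exact ((measurePreserving_sub_right (volume : Measure ℝ) a).prod
          (MeasurePreserving.id (volume : Measure (EuclideanSpace ℝ (Fin 3))))).quasiMeasurePreserving
      have hmaps : MapsTo
          (Prod.map (fun t : ℝ => t - a) (id : EuclideanSpace ℝ (Fin 3) → EuclideanSpace ℝ (Fin 3)))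
          (Ioo a d ×ˢ univ) (Ioo 0 (d - a) ×ˢ univ) := fun z hz =>
        ⟨⟨by show 0 < z.1 - a; linarith [hz.1.1], by show z.1 - a < d - a; linarith [hz.1.2]⟩,
          mem_univ _⟩
      refine (smoothReprAe_ae_comp hq (measurableSet_Ioo.prod MeasurableSet.univ)
        (measurableSet_Ioo.prod MeasurableSet.univ) hmaps hvae).mono fun z hz => ?_
      have hz' : w (z.1 - a + a) z.2 = v (z.1 - a) z.2 := hz
      rwa [sub_add_cancel] at hz'
  -- ## Step 3: gluing the window representatives
  choose v hvc hvd hvm hvae using hwin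
  have hW0 : ∀ n : ℕ, ∀ t ∈ Ioo (-(n + 2 : ℝ)) (-(n + 2 : ℝ)⁻¹), t < 0 := fun n t ht =>
    ht.2.trans (neg_neg_of_pos (inv_pos.2 (by positivity)))
  have hW2 : ∀ s t : ℝ, s ≤ t → t < 0 → ∃ m : ℕ,
      s ∈ Ioo (-(m + 2 : ℝ)) (-(m + 2 : ℝ)⁻¹) ∧ t ∈ Ioo (-(m + 2 : ℝ)) (-(m + 2 : ℝ)⁻¹) := by
    intro s t hst ht
    obtain ⟨m, hm⟩ := exists_nat_ge (max (-s) (-t)⁻¹)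
    have h1 : -s ≤ m := (le_max_left _ _).trans hm
    have h2 : ((m : ℝ) + 2)⁻¹ < -t :=
      inv_lt_of_inv_lt₀ (neg_pos.2 ht) (by linarith [(le_max_right _ _).trans hm])
    exact ⟨m, ⟨by linarith, by linarith⟩, ⟨by linarith, by linarith⟩⟩
  have hW1 : ∀ t : ℝ, ∃ m : ℕ, t < 0 → t ∈ Ioo (-(m + 2 : ℝ)) (-(m + 2 : ℝ)⁻¹) := fun t => by
    by_cases ht : t < 0
    · exact (hW2 t t le_rfl ht).imp fun m hm _ => hm.1
    · exact ⟨0, fun h => absurd h ht⟩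
  choose N hN using hW1
  -- two window representatives agree on the overlap (continuous, a.e. equal to `w`)
  have hagree : ∀ k n, EqOn (uncurry (v k)) (uncurry (v n))
      ((Ioo (-(k + 2 : ℝ)) (-(k + 2 : ℝ)⁻¹) ∩ Ioo (-(n + 2 : ℝ)) (-(n + 2 : ℝ)⁻¹)) ×ˢ univ) := by
    intro k n
    refine Measure.eqOn_open_of_ae_eq (μ := (volume : Measure (ℝ × EuclideanSpace ℝ (Fin 3)))) ?_
      ((isOpen_Ioo.inter isOpen_Ioo).prod isOpen_univ)
      ((hvc k).mono (prod_mono inter_subset_left Subset.rfl))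
      ((hvc n).mono (prod_mono inter_subset_right Subset.rfl))
    filter_upwards [ae_restrict_of_ae_restrict_of_subset (prod_mono inter_subset_left Subset.rfl)
      (hvae k), ae_restrict_of_ae_restrict_of_subset (prod_mono inter_subset_right Subset.rfl)
      (hvae n)] with z hz1 hz2
    rw [← hz1, ← hz2]
  set V : ℝ → EuclideanSpace ℝ (Fin 3) → EuclideanSpace ℝ (Fin 3) :=
    fun t x => if t < 0 then v (N t) t x else 0 with hV
  have hV0 : ∀ t, 0 ≤ t → ∀ x, V t x = 0 := fun t ht x => by simp only [hV, if_neg (not_lt.2 ht)]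
  have hloc : ∀ n : ℕ, ∀ t ∈ Ioo (-(n + 2 : ℝ)) (-(n + 2 : ℝ)⁻¹), ∀ x, V t x = v n t x :=
    fun n t ht x => by
    simp only [hV, if_pos (hW0 n t ht)]
    exact hagree (N t) n (x := (t, x)) ⟨⟨hN t (hW0 n t ht), ht⟩, mem_univ _⟩
  have hcont : ContinuousOn (uncurry V) (Iio 0 ×ˢ univ) := by
    rintro ⟨t, x⟩ ⟨ht, -⟩
    exact (((hvc (N t)).congr fun z hz => hloc (N t) z.1 hz.1 z.2).continuousAt
      ((isOpen_Ioo.prod isOpen_univ).mem_nhds ⟨hN t ht, mem_univ _⟩)).continuousWithinAt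
  have hae : ∀ᵐ z ∂(volume.restrict (Iio (0 : ℝ) ×ˢ (univ : Set (EuclideanSpace ℝ (Fin 3))))),
      uncurry w z = uncurry V z := by
    have hcover : Iio (0 : ℝ) ×ˢ (univ : Set (EuclideanSpace ℝ (Fin 3))) ⊆
        ⋃ n : ℕ, Ioo (-(n + 2 : ℝ)) (-(n + 2 : ℝ)⁻¹) ×ˢ (univ : Set (EuclideanSpace ℝ (Fin 3))) :=
      fun z hz => mem_iUnion.2 ⟨N z.1, hN z.1 hz.1, mem_univ _⟩
    refine ae_restrict_of_ae_restrict_of_subset hcover ((ae_restrict_iUnion_iff _ _).2 fun n => ?_)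
    filter_upwards [hvae n, ae_restrict_mem (measurableSet_Ioo.prod MeasurableSet.univ)]
      with z hz hzI
    exact hz.trans (hloc n z.1 hzI.1 z.2).symm
  have hdiv : ∀ t < 0, IsWeaklyDivFree (V t) := fun t ht => by
    rw [show V t = v (N t) t from funext fun x => hloc (N t) t (hN t ht) x]
    exact hvd (N t) t (hN t ht)
  have hmild : ∀ s t : ℝ, s < t → t < 0 → ∀ x,
      V t x = UnboundedOperators.heatExtension (V s) (t - s) x - oseenDuhamel 1 s V V t x := by
    intro s t hst ht x
    obtain ⟨m, hs, ht'⟩ := hW2 s t hst.le ht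
    rw [hloc m t ht' x, show V s = v m s from funext (hloc m s hs),
      oseenDuhamel_congr_Ioo (a' := v m) (b' := v m)
        (fun σ hσ => funext (hloc m σ ⟨hs.1.trans hσ.1, hσ.2.trans ht'.2⟩))
        (fun σ hσ => funext (hloc m σ ⟨hs.1.trans hσ.1, hσ.2.trans ht'.2⟩)) x]
    exact hvm m s t hs ht' hst x
  -- the Type I bound passes from `w` (everywhere) to the continuous representative
  have hdec : HasTypeIDecay C₀ V := by
    have hb : ContinuousOn (fun z : ℝ × EuclideanSpace ℝ (Fin 3) => C₀ / (‖z.2‖ + √(-z.1)))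
        (Iio (0 : ℝ) ×ˢ (univ : Set (EuclideanSpace ℝ (Fin 3)))) :=
      continuousOn_const.div
        (continuous_snd.norm.add (Real.continuous_sqrt.comp continuous_fst.neg)).continuousOn
        fun z hz => (add_pos_of_nonneg_of_pos (norm_nonneg _)
          (Real.sqrt_pos.2 (neg_pos.2 hz.1))).ne'
    have hn : ContinuousOn (fun z : ℝ × EuclideanSpace ℝ (Fin 3) => ‖V z.1 z.2‖)
        (Iio (0 : ℝ) ×ˢ (univ : Set (EuclideanSpace ℝ (Fin 3)))) :=
      hcont.norm
    have hEq := Measure.eqOn_open_of_ae_eq (μ := (volume : Measure (ℝ × EuclideanSpace ℝ (Fin 3))))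
      (f := fun z : ℝ × EuclideanSpace ℝ (Fin 3) => min ‖V z.1 z.2‖ (C₀ / (‖z.2‖ + √(-z.1)))) ?_
      (isOpen_Iio.prod isOpen_univ) (continuous_min.comp_continuousOn (hn.prodMk hb)) hn
    · exact fun t ht x => min_eq_left_iff.1 (hEq (x := (t, x)) ⟨ht, mem_univ _⟩)
    · filter_upwards [hae, ae_restrict_mem hS] with z hz hzS
      rw [← show w z.1 z.2 = V z.1 z.2 from hz]
      exact min_eq_left (hwb z.1 hzS.1 z.2)
  have hT : IsTypeIAncientMild C₀ V :=
    isTypeIAncientMild_of_continuous_oseenMild hcont hdiv hmild (hdec.hasTypeITimeDecay hC₀)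
  -- ## Step 4: slice-wise a.e. equality for EVERY `t < 0`
  -- `V` is again weak-* continuous in time (an ancient mild solution in the duality sense)
  have hwsV := fun θ hθ => smoothReprAe_weakStar hT.isAncientMildSolution
    (fun t ht => hT.aestronglyMeasurable_slice ht) hdec (θ := θ) hθ
  -- a.e. equality of the slices for a.e. `t < 0` (Fubini on the strip)
  have h1 : ∀ᵐ t ∂(volume.restrict (Iio (0 : ℝ))), V t =ᵐ[volume] u t := by
    rw [Measure.volume_eq_prod, ← Measure.restrict_prod_eq_prod_univ] at hae
    filter_upwards [Measure.ae_ae_of_ae_prod hae, ae_restrict_mem measurableSet_Iio] with t ht ht0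
    filter_upwards [ht, hwu t ht0] with x hx hx'
    rw [← show w t x = V t x from hx, hx']
  have haeq : ∀ t < 0, V t =ᵐ[volume] u t := by
    intro t ht
    have hlocV : LocallyIntegrable (V t) volume := (hT.continuous_slice ht).locallyIntegrable
    have hlocu : LocallyIntegrable (u t) volume :=
      (memLp_top_of_bound (hmeas t ht) (C₀ / √(-t))
        (Eventually.of_forall fun x => hC.hasTypeITimeDecay hC₀ t ht x)).locallyIntegrable le_top
    refine FunctionSpaces.ae_eq_of_forall_integral_inner_test_eq hlocV hlocu fun θ hθ => ?_
    have hg : (fun s => ∫ x, ⟪V s x, θ x⟫) =ᵐ[volume.restrict (Iio (0 : ℝ))]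
        fun s => ∫ x, ⟪u s x, θ x⟫ := by
      filter_upwards [h1] with s hs
      exact integral_congr_ae (hs.mono fun x hx => by
        show ⟪V s x, θ x⟫ = ⟪u s x, θ x⟫
        rw [hx])
    exact Measure.eqOn_open_of_ae_eq hg isOpen_Iio (hwsV θ hθ) (hws θ hθ) ht
  exact ⟨V, C₀, hT, hdec, haeq, fun t ht => funext fun x => hV0 t ht x⟩

end Summit.NavierStokesRegularity.NavierStokesRegularity.Theorems.PolyhedralDssProfileExists.PolyhedralCell
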